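import Mathlib.Analysis.Complex.HasPrimitives
import Mathlib.MeasureTheory.Integral.Prod
import Mathlib.MeasureTheory.Function.L2Space
import Literature.Analysis.Complex.LengthArea
import Literature.Probability.RandomPlanarGeometry.ConformalRemovability
import HarnessLib

/-!
# Conformal removability: the analytic layer of Jones–Smirnov's proof

Support for the proof of `JonesSmirnov2000_frontier_of_isHolderDomain` (Jones–Smirnov 2000, Cor. 2;
`ConformalRemovability.lean`). The printed proof (P. W. Jones, S. K. Smirnov, Ark. Mat. 38 (2000),
§2, pp. 269–270) runs: a homeomorphism that is quasiconformal off `K = ∂Ω` has `W^{1,2}`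
coordinates off `K`; Proposition 1 shows that it is ACL (absolutely continuous on almost every
line parallel to the axes); and "it is a well-known fact that to check quasiconformality of a
homeomorphism `f`, it is sufficient to check that it is ACL and quasiconformal almost everywhere"
(the analytic definition, Ahlfors, *Lectures on quasiconformal mappings*, Ch. II §B; Väisälä,
Thm. 34.6), which gives Theorem 1. This file proves the CONFORMAL (planar, `n = 2`) versions of the
two analytic inputs of that paragraph, with Mathlib's holomorphy in place of quasiconformality:

* `differentiableOn_of_rect_lineIdentities` — the analytic definition of holomorphy: a function `F`
  continuous on an open `U` such that, for every closed rectangle `R ⊆ U`, some `F' ∈ L¹(R)` is the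
  derivative of `F` along almost every horizontal side-to-side segment of `R` and `I • F'` along
  almost every vertical one (the fundamental theorem of calculus on a.e. line, with Cauchy–Riemann
  built in), is holomorphic on `U`: by Fubini every rectangle boundary integral vanishes, and
  Morera's theorem (Mathlib's `Complex.isConservativeOn_and_continuousOn_iff_isDifferentiableOn`)
  applies.
* `volume_image_eq_lintegral_deriv` — the area formula `area F(V) = ∫∫_V ‖F'‖²` for `F` injective
  and holomorphic on an open `V` (the tree's `LengthArea.volume_image_ball_eq_lintegral`, for a
  general open set; Mathlib's change of variables `lintegral_image_eq_lintegral_abs_det_fderiv_mul`),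
  whence `integrableOn_deriv_of_isOpen` and `integrableOn_deriv_rectangle`: for `F` continuous and
  injective on an open `U` and holomorphic on `U ∖ K`, `K` closed and Lebesgue-null, `deriv F ∈ L¹(R)`
  for every closed rectangle `R ⊆ U` ("the coordinate functions of any homeomorphism `f`
  quasiconformal in `Kᶜ` belong to `W^{1,n}` for bounded subsets of `Kᶜ`", p. 269, conformal case:
  `∫∫ ‖F'‖² = area` is finite on relatively compact pieces).

Nothing here is specific to Hölder domains; the geometric half of the proof (Whitney squares,
shadows, Proposition 1) is not in this file.

## References

* [JonesSmirnov2000] P. W. Jones, S. K. Smirnov, *Removability theorems for Sobolev functions and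
  quasiconformal maps*, Ark. Mat. 38 (2000) 263–279, §2 (pp. 269–270). doi:10.1007/BF02384320.
* L. V. Ahlfors, *Lectures on quasiconformal mappings*, Van Nostrand (1966), Ch. II §B.
-/

noncomputable section

open Set Filter Metric MeasureTheory Complex intervalIntegral
open scoped Topology NNReal ENNReal Interval

namespace Literature.Probability.RandomPlanarGeometry

variable {U K V : Set ℂ} {F F' : ℂ → ℂ}

/-! ### Points of a rectangle -/

/-- The point `x + y i` with `x ∈ [[re z, re w]]` and `y ∈ [[im z, im w]]` lies in the closed
rectangle with opposite corners `z`, `w`. [folklore] -/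
theorem ofReal_add_mul_I_mem_rectangle {z w : ℂ} {x y : ℝ} (hx : x ∈ [[z.re, w.re]])
    (hy : y ∈ [[z.im, w.im]]) : (x : ℂ) + y * I ∈ Rectangle z w := by
  refine mem_reProdIm.2 ⟨?_, ?_⟩ <;> simpa

/-! ### The analytic definition: line identities on a.e. line imply holomorphy -/

/-- **The analytic definition of holomorphy (conformal case of "ACL + quasiconformal a.e. ⇒
quasiconformal").** Let `F` be continuous on an open `U ⊆ ℂ` and suppose that for every closed
rectangle `R = Rectangle z w ⊆ U` some function `F'`, integrable on `R`, satisfies the fundamental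
theorem of calculus for `F` along almost every horizontal segment of `R` (with derivative `F'`) and
along almost every vertical segment of `R` (with derivative `I • F'`, i.e. the Cauchy–Riemann
equations hold a.e.). Then `F` is holomorphic on `U`. Proof: by the two families of identities and
Fubini, the integral of `F` over `∂R` equals `-I ∫∫_R F' + I ∫∫_R F' = 0`; conclude by Morera's
theorem. (Jones–Smirnov 2000, §2, p. 269: "to check quasiconformality of a homeomorphism it is
sufficient to check that it is ACL and quasiconformal almost everywhere", citing Ahlfors, *Lectures
on quasiconformal mappings*, II.B, and Väisälä, Thm. 34.6; here with `1`-quasiconformal =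
holomorphic.) [cite: JonesSmirnov2000, §2 p. 269] -/
theorem differentiableOn_of_rect_lineIdentities (hU : IsOpen U) (hFc : ContinuousOn F U)
    (h : ∀ z w : ℂ, Rectangle z w ⊆ U →
      IntegrableOn F' (Rectangle z w) ∧
      (∀ᵐ y : ℝ, y ∈ [[z.im, w.im]] →
        F (w.re + y * I) - F (z.re + y * I) = ∫ x in z.re..w.re, F' (x + y * I)) ∧
      (∀ᵐ x : ℝ, x ∈ [[z.re, w.re]] →
        F (x + w.im * I) - F (x + z.im * I) = I * ∫ y in z.im..w.im, F' (x + y * I))) :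
    DifferentiableOn ℂ F U := by
  refine (isConservativeOn_and_continuousOn_iff_isDifferentiableOn hU).1 ⟨fun z w hR => ?_, hFc⟩
  obtain ⟨hint, hH, hV⟩ := h z w hR
  rw [← add_eq_zero_iff_eq_neg, wedgeIntegral_add_wedgeIntegral_eq]
  simp only [smul_eq_mul]
  have hmem : ∀ x ∈ [[z.re, w.re]], ∀ y ∈ [[z.im, w.im]], (x : ℂ) + y * I ∈ U :=
    fun x hx y hy => hR (ofReal_add_mul_I_mem_rectangle hx hy)
  -- continuity of `F` along the horizontal and the vertical segments of `R`
  have hch : ∀ y ∈ [[z.im, w.im]],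
      IntervalIntegrable (fun x : ℝ => F (x + y * I)) volume z.re w.re := fun y hy =>
    (hFc.comp (continuous_ofReal.add continuous_const).continuousOn
      fun x hx => hmem x hx y hy).intervalIntegrable
  have hcv : ∀ x ∈ [[z.re, w.re]],
      IntervalIntegrable (fun y : ℝ => F (x + y * I)) volume z.im w.im := fun x hx =>
    (hFc.comp (continuous_const.add (continuous_ofReal.mul continuous_const)).continuousOn
      fun y hy => hmem x hx y hy).intervalIntegrable
  -- bottom minus top, by the vertical identities
  have h1 : (∫ x in z.re..w.re, F (x + z.im * I)) - (∫ x in z.re..w.re, F (x + w.im * I))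
      = -(I * ∫ x in z.re..w.re, ∫ y in z.im..w.im, F' (x + y * I)) := by
    rw [← integral_sub (hch _ left_mem_uIcc) (hch _ right_mem_uIcc), ← intervalIntegral.integral_const_mul,
      ← intervalIntegral.integral_neg]
    refine integral_congr_ae ?_
    filter_upwards [hV] with x hx hxmem
    have := hx (uIoc_subset_uIcc hxmem)
    linear_combination -this
  -- right minus left, by the horizontal identities
  have h2 : I * (∫ y in z.im..w.im, F (w.re + y * I)) - I * (∫ y in z.im..w.im, F (z.re + y * I))
      = I * ∫ y in z.im..w.im, ∫ x in z.re..w.re, F' (x + y * I) := by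
    rw [← mul_sub, ← integral_sub (hcv _ right_mem_uIcc) (hcv _ left_mem_uIcc)]
    congr 1
    refine integral_congr_ae ?_
    filter_upwards [hH] with y hy hymem
    exact hy (uIoc_subset_uIcc hymem)
  -- Fubini
  have h3 : (∫ x in z.re..w.re, ∫ y in z.im..w.im, F' (x + y * I))
      = ∫ y in z.im..w.im, ∫ x in z.re..w.re, F' (x + y * I) := by
    have hi : Integrable (Function.uncurry fun x y : ℝ => F' (x + y * I))
        ((volume.restrict (Ι z.re w.re)).prod (volume.restrict (Ι z.im w.im))) := by
      rw [Measure.prod_restrict, ← Measure.volume_eq_prod]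
      have hint' := hint
      rw [← (volume_preserving_equiv_real_prod.symm _).integrableOn_comp_preimage
        (MeasurableEquiv.measurableEmbedding _)] at hint'
      refine (hint'.mono_set ?_).congr_fun (fun p _ => ?_)
        (measurableSet_uIoc.prod measurableSet_uIoc)
      · intro p hp
        exact mem_reProdIm.2 ⟨uIoc_subset_uIcc hp.1, uIoc_subset_uIcc hp.2⟩
      · show F' (measurableEquivRealProd.symm p) = F' (p.1 + p.2 * I)
        rw [measurableEquivRealProd_symm_apply, mk_eq_add_mul_I]
    simp only [intervalIntegral_eq_integral_uIoc, MeasureTheory.integral_smul]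
    rw [integral_integral_swap hi]
    exact smul_comm _ _ _
  linear_combination h1 + h2 - I * h3

/-! ### The area formula and square integrability of the derivative -/

/-- **Area formula** for an injective holomorphic map of an open set `V ⊆ ℂ`:
`area (F (V)) = ∫∫_V ‖F'‖²` (change of variables with Jacobian `|det F'_ℝ| = ‖F'‖²`; the unit-disc
case is `LengthArea.volume_image_ball_eq_lintegral`). [folklore] -/
theorem volume_image_eq_lintegral_deriv (hV : IsOpen V) (hF : DifferentiableOn ℂ F V)
    (hinj : InjOn F V) :
    volume (F '' V) = ∫⁻ w in V, ENNReal.ofReal (‖deriv F w‖ ^ 2) := by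
  have hd : ∀ w ∈ V, HasFDerivWithinAt F
      ((ContinuousLinearMap.smulRight (1 : ℂ →L[ℂ] ℂ) (deriv F w)).restrictScalars ℝ) V w :=
    fun w hw ↦ ((hF.differentiableAt (hV.mem_nhds hw)).hasDerivAt.hasFDerivAt.restrictScalars ℝ)
      |>.hasFDerivWithinAt
  have := lintegral_image_eq_lintegral_abs_det_fderiv_mul volume hV.measurableSet hd hinj
    (fun _ ↦ 1)
  simp only [mul_one, lintegral_one, Measure.restrict_apply_univ] at this
  rw [this]
  refine setLIntegral_congr_fun hV.measurableSet fun w _ ↦ ?_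
  rw [Literature.Analysis.Complex.LengthArea.det_restrictScalars_smulRight,
    abs_of_nonneg (by positivity)]

/-- **The derivative of an injective holomorphic map is integrable** on an open set of finite area
whose image has finite area: `‖F'‖ ∈ L²(V)` by the area formula, and `L²(V) ⊆ L¹(V)`.
("The coordinate functions of any homeomorphism quasiconformal in `Kᶜ` belong to `W^{1,n}` for
bounded subsets of `Kᶜ`", Jones–Smirnov 2000, p. 269, conformal case.)
[cite: JonesSmirnov2000, §2 p. 269] -/
theorem integrableOn_deriv_of_isOpen (hV : IsOpen V) (hF : DifferentiableOn ℂ F V)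
    (hinj : InjOn F V) (hvol : volume V ≠ ∞) (himg : volume (F '' V) ≠ ∞) :
    IntegrableOn (deriv F) V := by
  haveI : IsFiniteMeasure (volume.restrict V) := isFiniteMeasure_restrict.2 hvol
  have hmeas : AEStronglyMeasurable (deriv F) (volume.restrict V) :=
    (measurable_deriv F).aestronglyMeasurable
  refine MemLp.integrable one_le_two ((memLp_two_iff_integrable_sq_norm hmeas).2 ⟨?_, ?_⟩)
  · exact ((measurable_deriv F).norm.pow_const 2).aestronglyMeasurable
  · rw [hasFiniteIntegral_iff_ofReal (Eventually.of_forall fun _ => by positivity),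
      ← volume_image_eq_lintegral_deriv hV hF hinj]
    exact himg.lt_top

/-- A closed rectangle is compact. [folklore] -/
theorem isCompact_rectangle (z w : ℂ) : IsCompact (Rectangle z w) :=
  Metric.isCompact_of_isClosed_isBounded (isClosed_Icc.reProdIm isClosed_Icc)
    ((isBounded_Icc _ _).reProdIm (isBounded_Icc _ _))

/-- **`W^{1,1}` on compact pieces.** Let `U` be open, `K` closed with `area K = 0`, and `F`
continuous and injective on `U` and holomorphic on `U ∖ K`. Then `deriv F` is integrable on every
closed rectangle `R ⊆ U`: thicken `R` inside `U`, apply `integrableOn_deriv_of_isOpen` on the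
thickening minus `K` (its image lies in the compact image of the closed thickening), and discard the
null set `K`. [cite: JonesSmirnov2000, §2 p. 269] -/
theorem integrableOn_deriv_rectangle (hU : IsOpen U) (hK : IsClosed K) (hK0 : volume K = 0)
    (hFc : ContinuousOn F U) (hFi : InjOn F U) (hFd : DifferentiableOn ℂ F (U \ K)) {z w : ℂ}
    (hR : Rectangle z w ⊆ U) : IntegrableOn (deriv F) (Rectangle z w) := by
  obtain ⟨δ, hδ, hδU⟩ := (isCompact_rectangle z w).exists_cthickening_subset_open hU hR
  have hT : IsCompact (cthickening δ (Rectangle z w)) := (isCompact_rectangle z w).cthickening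
  set V : Set ℂ := thickening δ (Rectangle z w) \ K with hVdef
  have hVT : V ⊆ cthickening δ (Rectangle z w) :=
    sdiff_subset.trans (thickening_subset_cthickening δ _)
  have hVo : IsOpen V := isOpen_thickening.sdiff hK
  have hVU : V ⊆ U \ K := sdiff_subset_sdiff_left ((thickening_subset_cthickening δ _).trans hδU)
  have hV : IntegrableOn (deriv F) V := by
    refine integrableOn_deriv_of_isOpen hVo (hFd.mono hVU) (hFi.mono (hVU.trans sdiff_subset))
      (lt_of_le_of_lt (measure_mono hVT) hT.measure_lt_top).ne ?_
    refine (lt_of_le_of_lt (measure_mono (image_mono hVT)) ?_).ne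
    exact (hT.image_of_continuousOn (hFc.mono hδU)).measure_lt_top
  have hKi : IntegrableOn (deriv F) K := by
    rw [IntegrableOn, Measure.restrict_eq_zero.2 hK0]
    exact integrable_zero_measure
  refine (hV.union hKi).mono_set fun p hp => ?_
  by_cases hpK : p ∈ K
  · exact Or.inr hpK
  · exact Or.inl ⟨self_subset_thickening hδ _ hp, hpK⟩

end Literature.Probability.RandomPlanarGeometry
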